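import Summits.ValiantsHypothesis.ValiantsHypothesis.Theorems.SymPencilOriginMoments
import Summits.ValiantsHypothesis.ValiantsHypothesis.Theorems.SymPencilOriginNormalForm
import Summits.ValiantsHypothesis.ValiantsHypothesis.Theorems.SymPencilIsotropicKernelDefect
import Summits.ValiantsHypothesis.ValiantsHypothesis.Theorems.SymPencilPerFourBlocksSq
import Summits.ValiantsHypothesis.ValiantsHypothesis.Theorems.SymPencilHomogeneousConeKernel
import Summits.ValiantsHypothesis.ValiantsHypothesis.Theorems.SymPencilSdcPerFour
import Literature.Computability.AlgebraicComplexity.AlperBogartVelascoBoxFour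

/-!
# Route `SymPencil` — `sdc(per_4) ≥ 19`: three more than the variable count
# (`--supports` stmt-ValiantsHypothesis-5674 `SdcSuperquadratic`)

**Theorem** (`nineteen_le_of_isSymm_isAffineDetRepr_perPoly_four`).  Over a field of
characteristic `0`, every SYMMETRIC affine determinantal representation of the `4 × 4` permanent
has size `m ≥ 19 = 4² + 3`.  (Tree: `17`, `SymPencilSdcPerFour` / `SymPencilSdcPerBeyondN`;
`18`, `SymPencilSdcPerFourEighteen`.)

Proof (`false_of_isSymm_isAffineDetRepr_perPoly_four_le`, uniform in `m ≤ 18`).  As in the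
`m = 17` file: kernel vector `w` of `A₀` (rank `m - 1`, von zur Gathen), normal form
`Pᵀ A₀ P = 0 ⊕ D`, `Pᵀ M(z) P = [[a, bᵀ],[b, C]]` (`SymPencilOriginNormalForm`), origin moments
(`SymPencilOriginMoments`): `a ≡ 0`, (i) `bᵀD⁻¹b ≡ 0`, (ii) `bᵀD⁻¹CD⁻¹b ≡ 0`,
(iii) `det D · bᵀD⁻¹CD⁻¹CD⁻¹b = -κ per_4`.  `V = ker b ⊂ Sing Z(per_4)` has `dim V ≤ 8`
(`finrank_le_eight_of_subperm_three_vanish`), `B = im b ⊂ K^{m-1}` is `D⁻¹`-isotropic so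
`2 dim B ≤ m - 1 ≤ 17`, and `dim V + dim B = 16`; hence `dim V = dim B = 8` and `B` is a MAXIMAL
isotropic subspace with defect `m - 1 - 16 ≤ 1`.  Then
`SymPencilIsotropicKernelDefect.sq_of_isotropic_defect_le_one`: `per_4 (u + s x) = e₀ + s e₁ +
s² c Λ_u(x)²` for all `u` and `x ∈ V`, and `SymPencilPerFourBlocksSq.finrank_le_four_of_sq`:
`dim V ≤ 4`.  Contradiction.

HONEST FRAMING: `+3` over the variable count for `n = 4` only; at `m = 19` the defect is `2` and the
`s²`-coefficient becomes a binary quadratic form, which the row filtration no longer controls;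
nothing here bears on `VP ≠ VNP`. [folklore]
-/
noncomputable section

-- single-conjunct layout: Sub = Summit, duplicated namespace component intended
set_option linter.dupNamespace false

namespace Summit.ValiantsHypothesis.ValiantsHypothesis.Theorems.SymPencilSdcPerFourNineteen

open Matrix MvPolynomial Module
open Literature.Computability.AlgebraicComplexity
open Literature.Computability.AlgebraicComplexity.AlperBogartVelasco
open Summit.ValiantsHypothesis.ValiantsHypothesis.Theorems.SymPencilHomogeneousHessianRank
open Summit.ValiantsHypothesis.ValiantsHypothesis.Theorems.SymPencilHomogeneousConeKernel
open Summit.ValiantsHypothesis.ValiantsHypothesis.Theorems.SymPencilHomogeneousDropRankCodim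
open Summit.ValiantsHypothesis.ValiantsHypothesis.Theorems.SymPencilOriginMoments
open Summit.ValiantsHypothesis.ValiantsHypothesis.Theorems.SymPencilOriginNormalForm
open Summit.ValiantsHypothesis.ValiantsHypothesis.Theorems.SymPencilIsotropicKernelDefect
open Summit.ValiantsHypothesis.ValiantsHypothesis.Theorems.SymPencilPerFourBlocksSq

/-- **No symmetric affine determinantal representation of `per_4` has size `≤ 18`**
(characteristic `0`). [folklore] -/
theorem false_of_isSymm_isAffineDetRepr_perPoly_four_le (K : Type*) [Field K] [CharZero K]
    {m : ℕ} (hm : m ≤ 18) {A : Matrix (Fin m) (Fin m) (MvPolynomial (Fin 4 × Fin 4) K)}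
    (hS : A.IsSymm) (hA : IsAffineDetRepr (perPoly (Fin 4) K) A) : False := by
  classical
  obtain ⟨hdeg, hdet⟩ := hA
  have hhom : (perPoly (Fin 4) K).IsHomogeneous 4 := by
    simpa using (perPoly_isHomogeneous (n := Fin 4) (k := K))
  -- the pencil `A = A₀ + Σ_v X_v A_v`
  set A₀ : Matrix (Fin m) (Fin m) K := constPart A with hA₀
  let Mlin : (Fin 4 × Fin 4 → K) →ₗ[K] Matrix (Fin m) (Fin m) K :=
    { toFun := fun z => ∑ v, z v • LRPencil.coeffMat A v
      map_add' := fun z₁ z₂ => by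
        simp only [Pi.add_apply, add_smul, Finset.sum_add_distrib]
      map_smul' := fun c z => by
        simp only [Pi.smul_apply, smul_eq_mul, mul_smul, Finset.smul_sum, RingHom.id_apply] }
  have hMlin : ∀ z, Mlin z = ∑ v, z v • LRPencil.coeffMat A v := fun z => rfl
  have hAz : ∀ z, A.map (eval z) = A₀ + Mlin z := fun z => by
    rw [hMlin, hA₀]
    exact LRPencil.map_eval_eq A hdeg z
  have hdetz : ∀ z, (A₀ + Mlin z).det = eval z (perPoly (Fin 4) K) := fun z => by
    rw [← hAz, ← RingHom.mapMatrix_apply, ← RingHom.map_det, hdet]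
  have hcoeffs : ∀ v, (LRPencil.coeffMat A v)ᵀ = LRPencil.coeffMat A v := fun v => by
    ext i j; simp only [transpose_apply, LRPencil.coeffMat_apply, hS.apply i j]
  have hA₀s : A₀ᵀ = A₀ := by
    ext i j; simp only [hA₀, transpose_apply, constPart_apply, hS.apply i j]
  have hMs : ∀ z, (Mlin z)ᵀ = Mlin z := fun z => by
    rw [hMlin, Matrix.transpose_sum]
    exact Finset.sum_congr rfl fun v _ => by rw [Matrix.transpose_smul, hcoeffs]
  have hMsingle : ∀ v, Mlin (Pi.single v 1) = LRPencil.coeffMat A v := fun v => by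
    rw [hMlin]
    rw [Finset.sum_eq_single v (fun u _ hu => by rw [Pi.single_eq_of_ne hu, zero_smul])
      (fun h => absurd (Finset.mem_univ v) h), Pi.single_eq_same, one_smul]
  -- regularity everywhere (von zur Gathen) and the kernel vector of `A₀`
  have hreg : ∀ x : Fin 4 × Fin 4 → K, m ≤ (A₀ + Mlin x).rank + 1 := fun x => by
    have h := AlperBogartVelasco.le_rank_map_eval_add_one two_ne_zero (by norm_num) A hdet x
    rwa [hAz] at h
  have hA₀det : A₀.det = 0 := by
    have h := hdetz 0
    rw [map_zero, add_zero] at h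
    rw [h]
    have h0 := eval_smul_of_isHomogeneous hhom (0 : K) (0 : Fin 4 × Fin 4 → K)
    rwa [zero_smul, zero_pow (by norm_num), zero_mul] at h0
  obtain ⟨w, hw, hA₀w⟩ := Matrix.exists_mulVec_eq_zero_iff.mpr hA₀det
  have hrank0 : m ≤ A₀.rank + 1 := by simpa using hreg 0
  -- `a ≡ 0` will follow from the moments; first the reindexing through `i₀` with `w i₀ ≠ 0`
  obtain ⟨i₀, hi₀⟩ : ∃ i, w i ≠ 0 := Function.ne_iff.mp hw
  let e : Fin m ≃ Unit ⊕ {i // i ≠ i₀} :=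
    { toFun := fun i => if h : i = i₀ then Sum.inl () else Sum.inr ⟨i, h⟩
      invFun := Sum.elim (fun _ => i₀) fun i => i.1
      left_inv := fun i => by
        by_cases h : i = i₀
        · simp [h]
        · simp [h]
      right_inv := by
        rintro (u | ⟨i, hi⟩)
        · simp
        · simp [hi] }
  have he0 : e.symm (Sum.inl ()) = i₀ := rfl
  have hcard : Fintype.card {i // i ≠ i₀} + 1 = m := by
    have hc : Fintype.card (Fin m) = Fintype.card (Unit ⊕ {i // i ≠ i₀}) := Fintype.card_congr e
    rw [Fintype.card_sum, Fintype.card_unit, Fintype.card_fin] at hc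
    omega
  set w' : Unit ⊕ {i // i ≠ i₀} → K := w ∘ e.symm with hw'
  have hre : ∀ N : Matrix (Fin m) (Fin m) K, Matrix.reindex e e N *ᵥ w' = (N *ᵥ w) ∘ e.symm := by
    intro N
    rw [Matrix.reindex_apply, Matrix.submatrix_mulVec_equiv]
    have hwe : w' ∘ e.symm.symm = w := by
      ext i
      simp [hw']
    rw [hwe]
  have hdot : ∀ u : Fin m → K, w' ⬝ᵥ (u ∘ e.symm) = w ⬝ᵥ u := fun u => by
    rw [hw']
    exact Fintype.sum_equiv e.symm _ _ fun i => rfl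
  set A₀' : Matrix (Unit ⊕ {i // i ≠ i₀}) (Unit ⊕ {i // i ≠ i₀}) K := Matrix.reindex e e A₀
    with hA₀'
  let Rm : Matrix (Fin m) (Fin m) K →ₗ[K]
      Matrix (Unit ⊕ {i // i ≠ i₀}) (Unit ⊕ {i // i ≠ i₀}) K :=
    (Matrix.reindexLinearEquiv K K e e).toLinearMap
  have hRm : ∀ N, Rm N = Matrix.reindex e e N := fun N => rfl
  set M' := Rm ∘ₗ Mlin with hM'
  have hM'z : ∀ z, M' z = Matrix.reindex e e (Mlin z) := fun z => rfl
  have hA₀'s : A₀'ᵀ = A₀' := by rw [hA₀', Matrix.transpose_reindex, hA₀s]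
  have hM's : ∀ z, (M' z)ᵀ = M' z := fun z => by rw [hM'z, Matrix.transpose_reindex, hMs]
  have hw'0 : w' (Sum.inl ()) ≠ 0 := by rw [hw', Function.comp_apply, he0]; exact hi₀
  have hA₀'w : A₀' *ᵥ w' = 0 := by rw [hA₀', hre, hA₀w]; rfl
  have hrank' : Fintype.card {i // i ≠ i₀} ≤ A₀'.rank := by
    rw [hA₀', Matrix.rank_reindex]; omega
  -- the origin normal form and homogeneity
  obtain ⟨hD, hDs, hCs, hblocks⟩ := det_origin_blocks A₀' hA₀'s w' hw'0 hA₀'w hrank' M' hM's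
  set D := A₀'.toBlocks₂₂ with hDdef
  have hdet' : ∀ (s : K) (z : Fin 4 × Fin 4 → K),
      (A₀' + s • M' z).det = s ^ 4 * eval z (perPoly (Fin 4) K) := by
    intro s z
    have h1 : A₀' + s • M' z = Matrix.reindex e e (A₀ + Mlin (s • z)) := by
      rw [hA₀', hM'z, map_smul]
      rfl
    rw [h1, Matrix.reindex_apply, Matrix.det_submatrix_equiv_self, hdetz,
      eval_smul_of_isHomogeneous hhom]
  -- the kernel-row and block families as linear maps
  let bL : (Fin 4 × Fin 4 → K) →ₗ[K] ({i // i ≠ i₀} → K) :=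
    { toFun := fun z i => (M' z *ᵥ w') (Sum.inr i)
      map_add' := fun z₁ z₂ => by
        ext i; simp only [map_add, Matrix.add_mulVec, Pi.add_apply]
      map_smul' := fun c z => by
        ext i; simp only [map_smul, Matrix.smul_mulVec, Pi.smul_apply, RingHom.id_apply] }
  have hbL : ∀ z, bL z = fun i => (M' z *ᵥ w') (Sum.inr i) := fun z => rfl
  let CL : (Fin 4 × Fin 4 → K) →ₗ[K] Matrix {i // i ≠ i₀} {i // i ≠ i₀} K :=
    { toFun := fun z => (M' z).toBlocks₂₂
      map_add' := fun z₁ z₂ => by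
        ext i j; simp only [map_add, Matrix.toBlocks₂₂, Matrix.add_apply, Matrix.of_apply]
      map_smul' := fun c z => by
        ext i j
        simp only [map_smul, Matrix.toBlocks₂₂, Matrix.smul_apply, Matrix.of_apply,
          RingHom.id_apply] }
  have hCL : ∀ z, CL z = (M' z).toBlocks₂₂ := fun z => rfl
  -- the origin moments, for every `z`
  have hmom : ∀ z : Fin 4 × Fin 4 → K, w' ⬝ᵥ M' z *ᵥ w' = 0 ∧ bL z ⬝ᵥ D⁻¹ *ᵥ bL z = 0 ∧
      bL z ⬝ᵥ (D⁻¹ * CL z * D⁻¹) *ᵥ bL z = 0 ∧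
      D.det * (bL z ⬝ᵥ (D⁻¹ * CL z * D⁻¹ * CL z * D⁻¹) *ᵥ bL z) =
        -(w' (Sum.inl ()) ^ 2 * eval z (perPoly (Fin 4) K)) := by
    intro z
    refine moments_four hD (w' ⬝ᵥ M' z *ᵥ w') (w' (Sum.inl ()) ^ 2) (eval z (perPoly (Fin 4) K))
      (bL z) fun s => ?_
    rw [hbL, hCL, hDdef, ← hblocks s z, hdet']
    ring
  have ha : ∀ z, w' ⬝ᵥ M' z *ᵥ w' = 0 := fun z => (hmom z).1
  -- `ker bL`: the kernel rows vanish entirely, so `A(v) w = 0`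
  have hMw : ∀ v, bL v = 0 → Mlin v *ᵥ w = 0 := by
    intro v hv
    have h1 : M' v *ᵥ w' = 0 := by
      have hinr : ∀ i, (M' v *ᵥ w') (Sum.inr i) = 0 := fun i => by
        have := congr_fun hv i
        rwa [hbL] at this
      have hinl : (M' v *ᵥ w') (Sum.inl ()) = 0 := by
        have h := ha v
        rw [dotProduct, Fintype.sum_sum_type] at h
        simp only [Finset.univ_unique, Finset.sum_singleton, hinr, mul_zero,
          Finset.sum_const_zero, add_zero, PUnit.default_eq_unit] at h
        exact (mul_eq_zero.1 h).resolve_left hw'0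
      ext (u | i)
      · exact hinl
      · exact hinr i
    rw [hM'z, hre] at h1
    ext j
    have := congr_fun h1 (e j)
    simpa using this
  -- all first partials of `per_4` vanish on `ker bL`
  have hpart : ∀ v, bL v = 0 → ∀ u : Fin 4 × Fin 4,
      eval v (pderiv u (perPoly (Fin 4) K)) = 0 := by
    intro v hv u
    set Y : Matrix (Fin m) (Fin m) K := A₀ + Mlin v with hYdef
    have hYs : Yᵀ = Y := by rw [hYdef, Matrix.transpose_add, hA₀s, hMs]
    have hYw : Y *ᵥ w = 0 := by rw [hYdef, Matrix.add_mulVec, hA₀w, hMw v hv, add_zero]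
    obtain ⟨c₀, hc₀⟩ := adjugate_eq_smul_vecMulVec hYs hw hYw (by
      have h := hreg v; rw [Fintype.card_fin]; exact h)
    rw [← hdet, DeterminantalConormal.eval_pderiv_det, hAz, ← hYdef, hc₀]
    have hcoe : A.map (fun p => eval v (pderiv u p)) = LRPencil.coeffMat A u := by
      ext i j
      simp only [Matrix.map_apply, LRPencil.coeffMat_apply,
        AlperBogartVelasco.pderiv_eq_C_coeff (hdeg i j), eval_C]
    rw [hcoe, Matrix.smul_mul, Matrix.trace_smul, Matrix.vecMulVec_mul, Matrix.trace_vecMulVec,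
      smul_eq_mul, ← Matrix.mulVec_transpose, hcoeffs, ← hMsingle, ← hdot, ← hre, ← hM'z,
      ha, mul_zero]
  -- dimension of the kernel: `≤ 8` (BoxFour)
  have hkerle : finrank K (LinearMap.ker bL) ≤ 8 :=
    finrank_le_eight_of_subperm_three_vanish (LinearMap.ker bL) fun x hx r c => by
      rw [← eval_pderiv_perPoly_eq_permanent_submatrix]
      exact hpart x (LinearMap.mem_ker.1 hx) (r, c)
  -- dimension of the image: `≤ 8` (isotropy)
  have hDis : (D⁻¹)ᵀ = D⁻¹ := by rw [Matrix.transpose_nonsing_inv, hDs]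
  have hDiu : IsUnit D⁻¹ :=
    (Matrix.isUnit_iff_isUnit_det _).2 (Matrix.isUnit_nonsing_inv_det_iff.2 hD)
  have hranle : 2 * finrank K (LinearMap.range bL) ≤ Fintype.card {i // i ≠ i₀} := by
    have h := rank_add_two_mul_finrank_le_of_quadratic_form_eq_zero hDis (LinearMap.range bL)
      (by rintro _ ⟨z, rfl⟩; exact (hmom z).2.1)
    rw [Matrix.rank_of_isUnit _ hDiu] at h
    omega
  have hrn := LinearMap.finrank_range_add_finrank_ker bL
  rw [Module.finrank_fintype_fun_eq_card, Fintype.card_prod, Fintype.card_fin] at hrn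
  have hker8 : finrank K (LinearMap.ker bL) = 8 := by omega
  have hL : Fintype.card {i // i ≠ i₀} ≤ 2 * finrank K (LinearMap.range bL) + 1 := by omega
  -- `per_4` is "affine + c (linear)²" along `ker bL`
  have hκ : w' (Sum.inl ()) ^ 2 ≠ 0 := pow_ne_zero 2 hw'0
  obtain ⟨c, hc⟩ := sq_of_isotropic_defect_le_one hD hDs bL CL hCs
    (fun z => eval z (perPoly (Fin 4) K)) hκ (fun z => (hmom z).2.1) (fun z => (hmom z).2.2.1)
    (fun z => (hmom z).2.2.2) hL
  have hsq : ∀ (u : Fin 4 × Fin 4 → K), ∃ Λ : (Fin 4 × Fin 4 → K) →ₗ[K] K,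
      ∀ y ∈ LinearMap.ker bL, ∃ e₀ e₁ : K, ∀ s : K,
      eval (u + s • y) (perPoly (Fin 4) K) = e₀ + s * e₁ + s ^ 2 * (c * (Λ y) ^ 2) := by
    intro u
    obtain ⟨Λ, hΛ⟩ := hc u
    exact ⟨Λ, fun y hy => hΛ y (LinearMap.mem_ker.1 hy)⟩
  have h4 := finrank_le_four_of_sq (LinearMap.ker bL) c hsq
  omega

/-- **`sdc(per_4) ≥ 19`** over any field of characteristic `0`: a symmetric affine determinantal
representation of `per_4` of size `m` has `19 ≤ m`. [folklore] -/
theorem nineteen_le_of_isSymm_isAffineDetRepr_perPoly_four (K : Type*) [Field K] [CharZero K]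
    {m : ℕ} {A : Matrix (Fin m) (Fin m) (MvPolynomial (Fin 4 × Fin 4) K)} (hS : A.IsSymm)
    (hA : IsAffineDetRepr (perPoly (Fin 4) K) A) : 19 ≤ m := by
  by_contra hlt
  exact false_of_isSymm_isAffineDetRepr_perPoly_four_le K (by omega) hS hA

/-- **`sdc(per_4) ≥ 4² + 3`** over `ℂ`, in the language of the route `SymPencil`: three more than
the number of variables, in the symmetric model, for `n = 4`. [folklore] -/
theorem sq_add_three_le_of_isSymm_isAffineDetRepr_perPoly_four (m : ℕ)
    (A : Matrix (Fin m) (Fin m) (MvPolynomial (Fin 4 × Fin 4) ℂ)) (hS : A.IsSymm)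
    (hA : IsAffineDetRepr (perPoly (Fin 4) ℂ) A) : 4 ^ 2 + 3 ≤ m :=
  nineteen_le_of_isSymm_isAffineDetRepr_perPoly_four ℂ hS hA

end Summit.ValiantsHypothesis.ValiantsHypothesis.Theorems.SymPencilSdcPerFourNineteen

end
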